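import Summits.NavierStokesRegularity.NavierStokesRegularity.Theorems.ScenarioCensusSilenceMeterRows
import HarnessLib

/-!
# LINE g16-4 «silence-meter» REV 2 port, part 3/4: §I (REV 2) SILENCE IN VOLUME — `quietSet`, `SilentInVolumeAlong`, `LoudFills`, the volume master law and the universal
# volume floor

Re-homed for the scenario census (typer seat ns-census-typer-1 g9; the cells A2si0 / A2siE / A2siP / A2siU (LINE g16-4, item 68, census v1.98) and A2siV / A2siW / A2siS (REV 2,
item 72, census v1.101) are MEMBERS OF RECORD «DECIDED IN KERNEL IN FILES» of block A2 (critic PASS; ref PRE-CHECK ✓ §18.8; lead label); this port makes them TREE-decided):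
VERBATIM PORT of ns-idea-2 LINE g16-4 «silence-meter» REV 2, `pub/ideators/ns-idea-2/lines/silence-meter/line-silence-meter.rev2.lean` sha16 72a7ac62b938520d (1078 l. =
rev 1 89ff24c1f2a7581c + §I–§K, lean check rc 0, 0 sorry), split for the 400-line rule into `ScenarioCensusSilenceMeter` (§A–§E) → `…SilenceMeterRows` (§F–§G) →
`…SilenceMeterVolume` (§I laws) → `…SilenceMeterVolumeRows` (§I rows, §J, §K + census KEYS).  Lean text VERBATIM in namespace `…Theorems.ScenarioCensus.SilenceMeter` (the
line's `…Lines.SilenceMeter` re-homed); port edits: `local notation "E3"` → `abbrev E3` (typer lint), `set_option linter.unusedVariables false` dropped (the record: a port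
must drop it; unused binders `_`-prefixed where the linter asks, proof text only), the `variable {C} {u}` line and `open MeasureTheory` repeated per part, the instrument `amp`
(+ `amp_nonneg`, `amp_le`) and the one-limit Liouville law `eq_zero_of_blowdownLimit_zero`, shared VERBATIM with the epoch-meter port, taken BY NAME (`EpochMeter.…`),
`@[conjecture]` on the OPEN rows `Row_A2siN` / `Row_A2siQ` and on the restated residuals `Row_A2arP` / `EnvelopeLiouville` (typed only), one-line docstrings added (gate
lint).  Statements untouched.

No census VALUE is moved here (the cells become TREE-decided by name; booking is the lead's); NS regularity is NOT proved; (L′) ⟨10661⟩ is untouched; no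
summit statement is proved by this file. Lemmas that restate already-landed tree declarations are taken BY NAME (gate lint `dedup.landed`): `amp` = `EpochMeter.amp`, `amp_nonneg` = `EpochMeter.amp_nonneg`, `amp_le` = `EpochMeter.amp_le`, `eq_zero_of_blowdownLimit_zero` = `EpochMeter.eq_zero_of_blowdownLimit_zero`.
-/

-- the summit and its single problem share the name `NavierStokesRegularity` (D-0017 nested layout)
set_option linter.dupNamespace false

noncomputable section

open Set Function Filter Metric
open scoped Topology
open Literature.Analysis.FluidPDE
open Summit.NavierStokesRegularity.NavierStokesRegularity.Theorems

namespace Summit.NavierStokesRegularity.NavierStokesRegularity.Theorems.ScenarioCensus.SilenceMeter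

open MeasureTheory

variable {C : ℝ} {u : ℝ → E3 → E3}

/-! ## I. (REV 2) SILENCE IN VOLUME — recurrent positive-volume silence is excluded; the loud set FILLS every
similarity ball (measure ⇒ analytic rigidity)

REV 2 sharpens the reading of § A from the MAXIMUM over the receding ball to the VOLUME of its quiet part.  In
similarity coordinates `η` (position `x = √(−s)·η`) the level-`δ` QUIET SET of the slice at time `s` inside
`B̄(η₀, ρ)` is `quietSet u δ η₀ ρ s = {η ∈ B̄(η₀, ρ) : EpochMeter.amp u s (√(−s)·η) ≤ δ}`; its Lebesgue measure is the similarity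
volume of the calm part of the profile at scale `√(−s)`.  `SilentInVolumeAlong u η₀ ρ v s`: along `s_k → −∞` the quiet
sets at levels `δ_k → 0` keep volume `≥ v`.  MASTER LAW (V) `eq_zero_of_silentInVolumeAlong`: for `v > 0` this forces
`u ≡ 0` — a singularity model cannot be asymptotically silent, along any sequence of far-past times, on sets of
positive similarity volume fraction in any similarity ball, however small the fraction.  Mechanism: blow-down along
`μ_k = √(−s_k)`; REVERSE FATOU for the quiet sets (`le_volume_limsupSet`: their limsup keeps volume `≥ v`); on the
limsup set the limit slice VANISHES (pointwise convergence against levels `→ 0`); so the zero set of the analytic limit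
slice has positive measure, hence the slice vanishes identically (MITYAGIN, tree fact `realAnalytic_zeroSet_null_holds`,
applied componentwise as in ns-idea-3's LINE 31 «dense-locus» — the «measure ⇒ analytic rigidity» move is CREDITED to
that line (F-block, forward blow-up zoom, Beltrami/calm/slow defects); here it is run on the A-block, for the amplitude,
under blow-DOWN along arbitrary far-past sequences and on arbitrary similarity balls); then `eq_zero_of_slice_zero`
and the one-limit Liouville law.  UNIVERSAL QUIET-VOLUME LAW `universal_quietVolume` / `loudFills_of_ne_zero`
(compactness + `substantial_at_large_scales` + the same chain): for every `C`, every ball `B̄(η₀, ρ)` and every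
`v > 0` there is `f = f(C, η₀, ρ, v) > 0` such that for every NONZERO `u ∈ A_C`, at EVERY time `s < T(u)`, the `f`-quiet
part of `√(−s)·B̄(η₀, ρ)` has similarity volume `< v` — the `f`-LOUD set fills all of every similarity ball but a
fraction that can be made as small as desired by lowering the level, UNIFORMLY over the class.  N1 datum (TEXT ONLY):
Type-I singularity models are VOLUME-FILLING at the self-similar scale — no β-model / multifractal intermittency of
the activity in similarity variables (activity cannot concentrate on sheets, tubes or dust of small relative volume
in any similarity ball at far-past times).  ROWS: `Row_A2siV` (recurrent positive-volume silence ⇒ 0) and `Row_A2siW`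
(quiet volume `≥ v` at the universal level along a sequence ⇒ 0) EXCLUDED — PROVED; nestings `W ⇒ V ⇒ 0(sup row)`.
§ J types the FIXED-LEVEL residual `Row_A2siQ` (ONE receding ball eventually `ε`-quiet at a fixed `ε < 1` ⇒ 0): OPEN,
and PROVED to be the hardest amplitude-quietness cell of the series — `Row_A2siQ → Row_A2arP` (g16-2's residual) and
hence `→ EnvelopeLiouville`. -/

/-- QUIET SET at level `δ` (similarity coordinates): positions `η ∈ B̄(η₀, ρ)` whose reading at time `s` is `≤ δ`. -/
def quietSet (u : ℝ → E3 → E3) (δ : ℝ) (η₀ : E3) (ρ s : ℝ) : Set E3 :=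
  {η | η ∈ Metric.closedBall η₀ ρ ∧ EpochMeter.amp u s (Real.sqrt (-s) • η) ≤ δ}

/-- Reading «SILENT IN VOLUME along `s` at volume `v`»: far-past times `s_k → −∞` and levels `δ_k → 0` whose quiet sets
in `B̄(η₀, ρ)` keep similarity volume `≥ v`. -/
def SilentInVolumeAlong (u : ℝ → E3 → E3) (η₀ : E3) (ρ v : ℝ) (s : ℕ → ℝ) : Prop :=
  (∀ k, s k < 0) ∧ Tendsto s atTop atBot ∧
    ∃ δ : ℕ → ℝ, Tendsto δ atTop (𝓝 0) ∧ ∀ k, ENNReal.ofReal v ≤ volume (quietSet u (δ k) η₀ ρ (s k))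

/-- Reading «the `f`-LOUD set FILLS `√(−s)·B̄(η₀, ρ)` up to volume `v` before `T`»: at every time `s < T` the `f`-quiet
part has similarity volume `< v`. -/
def LoudFills (u : ℝ → E3 → E3) (η₀ : E3) (ρ f v : ℝ) : Prop :=
  ∃ T < 0, ∀ s < T, volume (quietSet u f η₀ ρ s) < ENNReal.ofReal v

/-- **Reverse Fatou for sets** (PROVED; elementary): measurable sets `A j ⊆ B` of a set `B` of finite volume, each of
volume `≥ a`, have a limsup `⋂ₙ ⋃_{j ≥ n} A j` of volume `≥ a` (continuity of the measure from above along the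
decreasing unions). -/
theorem le_volume_limsupSet {A : ℕ → Set E3} {B : Set E3} (hB : volume B ≠ ⊤) (hAB : ∀ j, A j ⊆ B)
    (hmeas : ∀ j, MeasurableSet (A j)) {a : ENNReal} (ha : ∀ j, a ≤ volume (A j)) :
    a ≤ volume (⋂ n : ℕ, ⋃ j : ℕ, ⋃ (_ : n ≤ j), A j) := by
  set U : ℕ → Set E3 := fun n => ⋃ j : ℕ, ⋃ (_ : n ≤ j), A j with hU
  have hUm : ∀ n, NullMeasurableSet (U n) volume := fun n =>
    (MeasurableSet.iUnion fun j => MeasurableSet.iUnion fun _ => hmeas j).nullMeasurableSet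
  have hanti : Antitone U := by
    intro m n hmn x hx
    simp only [hU, Set.mem_iUnion] at hx ⊢
    obtain ⟨j, hj, hx⟩ := hx
    exact ⟨j, hmn.trans hj, hx⟩
  have hU0 : U 0 ⊆ B := by
    intro x hx
    simp only [hU, Set.mem_iUnion] at hx
    obtain ⟨j, -, hx⟩ := hx
    exact hAB j hx
  have hfin : ∃ n, volume (U n) ≠ ⊤ := ⟨0, ne_top_of_le_ne_top hB (measure_mono hU0)⟩
  have ht := tendsto_measure_iInter_atTop hUm hanti hfin
  refine ge_of_tendsto' ht fun n => ?_
  exact (ha n).trans (measure_mono fun x hx => Set.mem_iUnion.2 ⟨n, Set.mem_iUnion.2 ⟨le_rfl, hx⟩⟩)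

/-- **Mityagin on slices** (tree fact `realAnalytic_zeroSet_null_holds`, applied componentwise exactly as in ns-idea-3's
LINE 31 «dense-locus» — credited): an `ℝ³`-valued map real-analytic on all of `ℝ³` whose zero set has NON-ZERO volume
vanishes identically. -/
theorem eq_zero_of_analyticOnNhd_of_volume_zeroSet_ne_zero {G : E3 → E3} (hG : AnalyticOnNhd ℝ G Set.univ)
    (hpos : volume {η : E3 | G η = 0} ≠ 0) : ∀ η, G η = 0 := by
  have hcomp : ∀ i : Fin 3, ∀ η, G η i = 0 := by
    intro i
    by_contra hne
    push Not at hne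
    obtain ⟨η₁, hη₁⟩ := hne
    have hA : AnalyticOnNhd ℝ (fun η => G η i) Set.univ := by
      have h := (EuclideanSpace.proj (𝕜 := ℝ) i).comp_analyticOnNhd hG
      simpa [Function.comp_def] using h
    have hnull := Literature.Analysis.Calculus.realAnalytic_zeroSet_null_holds 3 Set.univ (fun η => G η i)
      isOpen_univ isConnected_univ hA ⟨η₁, Set.mem_univ _, hη₁⟩
    refine hpos (measure_mono_null (fun η hη => ?_) hnull)
    refine ⟨Set.mem_univ _, ?_⟩
    have hη' : G η = 0 := hη
    simp only [hη']
    rfl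
  intro η
  ext i
  exact hcomp i η

/-- **Limit lemma** (PROVED; the measure-theoretic core of § I): continuous maps `g j → G` pointwise, whose quiet sets
`{η ∈ B̄(η₀, ρ) : ‖g j η‖ ≤ δ_j}` at levels `δ_j → 0` keep volume `≥ v > 0`, have a limit whose ZERO SET has non-zero
volume: the limsup of the quiet sets has volume `≥ v` (reverse Fatou) and `G` vanishes on it. -/
theorem volume_zeroSet_ne_zero_of_quietSets {g : ℕ → E3 → E3} {G : E3 → E3} (hg : ∀ j, Continuous (g j))
    (hlim : ∀ η, Tendsto (fun j => g j η) atTop (𝓝 (G η))) {η₀ : E3} {ρ v : ℝ} (hv : 0 < v) {δ : ℕ → ℝ}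
    (hδ : Tendsto δ atTop (𝓝 0))
    (hvol : ∀ j, ENNReal.ofReal v ≤ volume {η : E3 | η ∈ Metric.closedBall η₀ ρ ∧ ‖g j η‖ ≤ δ j}) :
    volume {η : E3 | G η = 0} ≠ 0 := by
  set Q : ℕ → Set E3 := fun j => {η : E3 | η ∈ Metric.closedBall η₀ ρ ∧ ‖g j η‖ ≤ δ j} with hQ
  have hQB : ∀ j, Q j ⊆ Metric.closedBall η₀ ρ := fun j η hη => hη.1
  have hQm : ∀ j, MeasurableSet (Q j) := fun j =>
    Metric.isClosed_closedBall.measurableSet.inter (isClosed_le (hg j).norm continuous_const).measurableSet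
  have hfin : volume (Metric.closedBall η₀ ρ) ≠ ⊤ := (isCompact_closedBall η₀ ρ).measure_lt_top.ne
  have hlimsup : ENNReal.ofReal v ≤ volume (⋂ n : ℕ, ⋃ j : ℕ, ⋃ (_ : n ≤ j), Q j) :=
    le_volume_limsupSet hfin hQB hQm hvol
  have hzero : (⋂ n : ℕ, ⋃ j : ℕ, ⋃ (_ : n ≤ j), Q j) ⊆ {η : E3 | G η = 0} := by
    intro η hη
    have hfreq : ∃ᶠ j in atTop, ‖g j η‖ ≤ δ j := by
      rw [Filter.frequently_atTop]
      intro n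
      have hn := Set.mem_iInter.1 hη n
      simp only [Set.mem_iUnion] at hn
      obtain ⟨j, hj, hjQ⟩ := hn
      exact ⟨j, hj, hjQ.2⟩
    show G η = 0
    by_contra hne
    have ha : 0 < ‖G η‖ := norm_pos_iff.2 hne
    have h1 : ∀ᶠ j in atTop, ‖G η‖ / 2 < ‖g j η‖ := ((hlim η).norm).eventually (lt_mem_nhds (by linarith))
    have h2 : ∀ᶠ j in atTop, δ j < ‖G η‖ / 2 := hδ.eventually (gt_mem_nhds (by linarith))
    obtain ⟨j, hjle, hj1, hj2⟩ := (hfreq.and_eventually (h1.and h2)).exists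
    linarith
  intro h0
  have hle : ENNReal.ofReal v ≤ 0 := (hlimsup.trans (measure_mono hzero)).trans h0.le
  have h0' : ENNReal.ofReal v = 0 := nonpos_iff_eq_zero.1 hle
  rw [ENNReal.ofReal_eq_zero] at h0'
  linarith

/-- Blow-down along `μ_k = √(−s_k)` under SILENCE IN VOLUME: the limit's slice at time `−1` vanishes IDENTICALLY (its
zero set has positive volume by the limit lemma, and it is real-analytic — Mityagin). -/
theorem exists_blowdownLimit_of_silentInVolumeAlong (hu : IsTypeIAncientMild C u) {η₀ : E3} {ρ v : ℝ} {s : ℕ → ℝ}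
    (hv : 0 < v) (hs : SilentInVolumeAlong u η₀ ρ v s) :
    ∃ W, ScenarioCensus.ScrewBlowdown.IsBlowdownLimit C u W ∧ ∀ y, W (-1) y = 0 := by
  obtain ⟨hs0, hslim, δ, hδ, hvol⟩ := hs
  set μ : ℕ → ℝ := fun k => Real.sqrt (-s k) with hμdef
  have hμk : ∀ k, μ k = Real.sqrt (-s k) := fun k => by rw [hμdef]
  have hμpos : ∀ k, 0 < μ k := fun k => Real.sqrt_pos.2 (by linarith [hs0 k])
  have hμsq : ∀ k, μ k ^ 2 = -s k := fun k => Real.sq_sqrt (by linarith [hs0 k])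
  have hμlim : Tendsto μ atTop atTop := by
    have h1 : Tendsto (fun k => -s k) atTop atTop := tendsto_neg_atBot_atTop.comp hslim
    refine tendsto_atTop_atTop.2 fun B => ?_
    obtain ⟨N, hN⟩ := tendsto_atTop_atTop.1 h1 (B ^ 2)
    refine ⟨N, fun k hk => (le_abs_self B).trans ?_⟩
    rw [← Real.sqrt_sq_eq_abs]
    exact Real.sqrt_le_sqrt (hN k hk)
  obtain ⟨φ, hφ, W, hW, hpt, -, hloc, -⟩ :=
    exists_tendsto_of_isTypeIAncientMild_seq C (w := fun k => nsRescale (μ k) u)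
      fun k => isTypeIAncientMild_nsRescale hu (hμpos k)
  have hBD : ScenarioCensus.ScrewBlowdown.IsBlowdownLimit C u W :=
    ⟨hW, fun j => μ (φ j), fun j => hμpos _, hμlim.comp hφ.tendsto_atTop, fun t ht => hloc t ht⟩
  refine ⟨W, hBD, ?_⟩
  have hsub : ∀ j, quietSet u (δ (φ j)) η₀ ρ (s (φ j)) ⊆
      {η : E3 | η ∈ Metric.closedBall η₀ ρ ∧ ‖nsRescale (μ (φ j)) u (-1) η‖ ≤ δ (φ j)} := by
    intro j η hη
    refine ⟨hη.1, ?_⟩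
    have ht : μ (φ j) ^ 2 * (-1 : ℝ) = s (φ j) := by rw [hμsq]; ring
    rw [← amp_neg_one, amp_nsRescale (hμpos _), ht, hμk]
    exact hη.2
  have hpos : volume {η : E3 | W (-1) η = 0} ≠ 0 :=
    volume_zeroSet_ne_zero_of_quietSets (G := W (-1))
      (fun j => (isTypeIAncientMild_nsRescale hu (hμpos (φ j))).continuous_slice (by norm_num))
      (fun η => hpt (-1) (by norm_num) η) hv (hδ.comp hφ.tendsto_atTop)
      (fun j => (hvol (φ j)).trans (measure_mono (hsub j)))
  exact eq_zero_of_analyticOnNhd_of_volume_zeroSet_ne_zero (hW.analyticOnNhd_slice_univ (by norm_num)) hpos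

/-- **MASTER LAW (V)** (PROVED): a Type-I ancient mild field that is SILENT IN VOLUME — along ONE sequence of far-past
times `s_k → −∞`, at levels `δ_k → 0`, on quiet sets of similarity volume `≥ v > 0` inside ONE similarity ball — is
identically zero. -/
theorem eq_zero_of_silentInVolumeAlong (hu : IsTypeIAncientMild C u) {η₀ : E3} {ρ v : ℝ} {s : ℕ → ℝ} (hv : 0 < v)
    (hs : SilentInVolumeAlong u η₀ ρ v s) : ∀ t < 0, ∀ x, u t x = 0 := by
  obtain ⟨W, hW, h0⟩ := exists_blowdownLimit_of_silentInVolumeAlong hu hv hs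
  exact EpochMeter.eq_zero_of_blowdownLimit_zero hu hW (eq_zero_of_slice_zero hW.1 (by norm_num) h0)

/-- Silence (§ A, maxima `→ 0`) is silence in volume at the full volume of the ball: REV 2 extends the master law. -/
theorem silentInVolumeAlong_of_silentAlong {η₀ : E3} {ρ : ℝ} {s : ℕ → ℝ} (hs : SilentAlong u η₀ ρ s) :
    SilentInVolumeAlong u η₀ ρ (volume (Metric.closedBall η₀ ρ)).toReal s := by
  obtain ⟨hs0, hslim, δ, hδ, hq⟩ := hs
  refine ⟨hs0, hslim, δ, hδ, fun k => ENNReal.ofReal_toReal_le.trans (measure_mono fun η hη => ⟨hη, ?_⟩)⟩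
  have hμpos : 0 < Real.sqrt (-s k) := Real.sqrt_pos.2 (by linarith [hs0 k])
  have hmem : Real.sqrt (-s k) • η ∈ simBall η₀ ρ (Real.sqrt (-s k) ^ 2 * (-1)) := by
    have hη' : η ∈ simBall η₀ ρ (-1) := by rwa [simBall_neg_one]
    exact smul_mem_simBall hμpos (by norm_num) hη'
  have ht : Real.sqrt (-s k) ^ 2 * (-1 : ℝ) = s k := by rw [Real.sq_sqrt (by linarith [hs0 k])]; ring
  rw [ht] at hmem
  exact hq k _ hmem

/-- **UNIVERSAL QUIET-VOLUME LAW** (PROVED): for every `C`, every similarity ball `B̄(η₀, ρ)` and every `v > 0` there is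
`f = f(C, η₀, ρ, v) > 0` such that NO nonzero `u ∈ A_C` keeps `f`-quiet sets of similarity volume `≥ v` in
`√(−s_k)·B̄(η₀, ρ)` along a sequence `s_k → −∞`.  (Offenders zoomed beyond their substantiality thresholds are
`ε_C`-loud at points `‖y_n‖ ≤ K_C` and `1/(n+1)`-quiet on sets of volume `≥ v`; a class limit is loud at `(−1, y_∞)` yet
its slice at `−1` has a zero set of positive volume, hence vanishes — contradiction.) -/
theorem universal_quietVolume (C : ℝ) (η₀ : E3) (ρ : ℝ) {v : ℝ} (hv : 0 < v) :
    ∃ f > (0 : ℝ), ∀ u : ℝ → E3 → E3, IsTypeIAncientMild C u → (∃ t < (0 : ℝ), ∃ x, u t x ≠ 0) →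
      ∀ s : ℕ → ℝ, (∀ k, s k < 0) → Tendsto s atTop atBot →
        ∃ k, volume (quietSet u f η₀ ρ (s k)) < ENNReal.ofReal v := by
  by_contra H
  push Not at H
  obtain ⟨ε, hε, K, hK, hsub⟩ := ScenarioCensus.ScrewBlowdown.substantial_at_large_scales C
  have hn : ∀ n : ℕ, ∃ w : ℝ → E3 → E3, IsTypeIAncientMild C w ∧ (∃ y : E3, ‖y‖ ≤ K ∧ ε < ‖w (-1) y‖) ∧
      ENNReal.ofReal v ≤ volume {η : E3 | η ∈ Metric.closedBall η₀ ρ ∧ ‖w (-1) η‖ ≤ 1 / ((n : ℝ) + 1)} := by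
    intro n
    obtain ⟨u, hu, hne, s, hs0, hslim, hq⟩ := H (1 / ((n : ℝ) + 1)) (by positivity)
    obtain ⟨μ₁, hμ₁, hloud⟩ := hsub u hu hne
    have hev : ∀ᶠ k in atTop, μ₁ ^ 2 ≤ -s k := (tendsto_neg_atBot_atTop.comp hslim).eventually_ge_atTop _
    obtain ⟨k, hk⟩ := hev.exists
    have hsk : 0 < -s k := by linarith [hs0 k]
    set μ : ℝ := Real.sqrt (-s k) with hμdef
    have hμpos : 0 < μ := Real.sqrt_pos.2 hsk
    have hμsq : μ ^ 2 = -s k := Real.sq_sqrt hsk.le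
    have hμ₁le : μ₁ ≤ μ := by
      calc μ₁ = Real.sqrt (μ₁ ^ 2) := (Real.sqrt_sq hμ₁.le).symm
        _ ≤ Real.sqrt (-s k) := Real.sqrt_le_sqrt hk
    refine ⟨nsRescale μ u, isTypeIAncientMild_nsRescale hu hμpos, hloud μ hμ₁le,
      (hq k).trans (measure_mono fun η hη => ⟨hη.1, ?_⟩)⟩
    have ht : μ ^ 2 * (-1 : ℝ) = s k := by rw [hμsq]; ring
    rw [← amp_neg_one, amp_nsRescale hμpos, ht, hμdef]
    exact hη.2
  choose w hw hyw hqw using hn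
  choose y hyK hyε using hyw
  obtain ⟨yL, -, ψ, hψ, hylim⟩ := (isCompact_closedBall (0 : E3) K).tendsto_subseq
    (fun n => show y n ∈ Metric.closedBall (0 : E3) K by
      rw [Metric.mem_closedBall, dist_zero_right]; exact hyK n)
  obtain ⟨φ, hφ, V, hV, hpt, -, hloc, -⟩ :=
    exists_tendsto_of_isTypeIAncientMild_seq C (w := fun j => w (ψ j)) fun j => hw (ψ j)
  have hL1 : Tendsto (fun j => w (ψ (φ j)) (-1) (y (ψ (φ j)))) atTop (𝓝 (V (-1) yL)) :=
    (hloc (-1) (by norm_num)).tendsto_comp (hV.continuous_slice (by norm_num)).continuousAt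
      (hylim.comp hφ.tendsto_atTop)
  have hVy : ε ≤ ‖V (-1) yL‖ := ge_of_tendsto' hL1.norm fun j => (hyε (ψ (φ j))).le
  have hδ : Tendsto (fun j => 1 / ((ψ (φ j) : ℝ) + 1)) atTop (𝓝 0) :=
    tendsto_one_div_add_atTop_nhds_zero_nat.comp ((hψ.comp hφ).tendsto_atTop)
  have hpos : volume {η : E3 | V (-1) η = 0} ≠ 0 :=
    volume_zeroSet_ne_zero_of_quietSets (G := V (-1)) (g := fun j => w (ψ (φ j)) (-1))
      (fun j => (hw (ψ (φ j))).continuous_slice (by norm_num))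
      (fun η => hpt (-1) (by norm_num) η) hv hδ (fun j => hqw (ψ (φ j)))
  have hV0 := eq_zero_of_analyticOnNhd_of_volume_zeroSet_ne_zero (hV.analyticOnNhd_slice_univ (by norm_num)) hpos
  rw [hV0 yL, norm_zero] at hVy
  exact absurd hVy (not_le.2 hε)

/-- **THE LOUD SET FILLS EVERY SIMILARITY BALL** (PROVED, every-time form of the universal quiet-volume law): with
`f = f(C, η₀, ρ, v)`, every NONZERO `u ∈ A_C` has, at EVERY time before some `T(u) < 0`, an `f`-quiet part of
`√(−s)·B̄(η₀, ρ)` of similarity volume `< v`. -/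
theorem loudFills_of_ne_zero (C : ℝ) (η₀ : E3) (ρ : ℝ) {v : ℝ} (hv : 0 < v) :
    ∃ f > (0 : ℝ), ∀ u : ℝ → E3 → E3, IsTypeIAncientMild C u → (∃ t < (0 : ℝ), ∃ x, u t x ≠ 0) →
      LoudFills u η₀ ρ f v := by
  obtain ⟨f, hf, hfl⟩ := universal_quietVolume C η₀ ρ hv
  refine ⟨f, hf, fun u hu hne => ?_⟩
  by_contra H
  simp only [LoudFills, not_exists, not_and, not_forall, not_lt] at H
  have h' : ∀ k : ℕ, ∃ s < -((k : ℝ) + 1), ENNReal.ofReal v ≤ volume (quietSet u f η₀ ρ s) := by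
    intro k
    obtain ⟨s, hs, hs'⟩ := H (-((k : ℝ) + 1)) (by linarith [(Nat.cast_nonneg k : (0 : ℝ) ≤ k)])
    exact ⟨s, hs, hs'⟩
  choose s hs hq using h'
  have hs0 : ∀ k, s k < 0 := fun k => by linarith [hs k, (Nat.cast_nonneg k : (0 : ℝ) ≤ k)]
  have hlin : Tendsto (fun k : ℕ => -((k : ℝ) + 1)) atTop atBot :=
    tendsto_neg_atTop_atBot.comp (tendsto_atTop_add_const_right atTop (1 : ℝ) tendsto_natCast_atTop_atTop)
  have hslim : Tendsto s atTop atBot := tendsto_atBot_mono (fun k => (hs k).le) hlin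
  obtain ⟨k, hlt⟩ := hfl u hu hne s hs0 hslim
  exact absurd (hq k) (not_le.2 hlt)

end Summit.NavierStokesRegularity.NavierStokesRegularity.Theorems.ScenarioCensus.SilenceMeter

end
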